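import Literature.AlgebraicGeometry.AbelianSchemes.AbelianSchemeDualPairBaseChange
import Literature.AlgebraicGeometry.AbelianSchemes.AbelianSchemePolarization
import Literature.AlgebraicGeometry.Modules.DetClassTensor
import Literature.AlgebraicGeometry.Modules.DetClassDual
import Literature.AlgebraicGeometry.AbelianVarieties.TheoremOfTheSquareCechPic
import Literature.AlgebraicGeometry.Motives.AbelianVarietyWeilPairingAlgClosure
import HarnessLib

/-!
# Mumford's `λ̄ = Λ(𝒪(Θ))` under base change: the fibres of `A ×_S S'` and [MFK94] Def. 6.2 transported along
# `(A_{S'})_t ≅ A_{t ≫ g}` ([MFK94] Ch. 6 §2 Def. 6.2–6.3, Ch. 7 §2 Def. 7.2; Görtz–Wedhorn I (4.7))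

Layer `Literature/AlgebraicGeometry/AbelianSchemes`, namespace `Literature.AlgebraicGeometry.AbelianSchemes.AbelianSchemeOver`.
Cell `hodgecm-mathlib`, rung-0 junction D-BC∃ (D2-third §3a, after ★ `AbelianSchemeBaseChangeComp`, ★
`AbelianSchemeDualPairBaseChange`; consumed by `AbelianSchemePolarizationBaseChange`).  One definition with body
(`fibrePointsMulEquiv`), one `abbrev` (`divisorBaseChange`), theorems; no named fact, no instance, no notation.
Data: an abelian scheme `A/S` with dual pair `D = (Â, 𝒫)` (★ `DualPair`), `λ : A → Â` over `S`, `g : S' ⟶ S`, a geometric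
point `t : Spec Ω → S'`, and the fibre identification `e := A.fibreBaseChangeIso g t : (A_{S'})_t ≅ A_{t ≫ g}` (★).
* §1 `isIso_toSchemeHom_fibreBaseChangeIso{,_inv}`, `e⁻¹ ≫ e = 𝟙 = e ≫ e⁻¹` on schemes,
  `cechPic_pullback_fibreBaseChangeIso_injective` (`e^*` is injective on `Ȟ¹(A_{t ≫ g}, 𝒪^×)`; ★ `CechPic.pullback_id`),
  **`fibrePointsMulEquiv : (A_{S'})_t(Ω) ≃* A_{t ≫ g}(Ω)`** (`P' ↦ P' ≫ e`), the values of `λ̄' = (λ ×_S S')‾` against `λ̄`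
  (`valueAt_baseChange_comp_fst/_snd`, `valueAt_baseChange_eq_iff`), and **the slice square**
  `sliceAt_baseChange_comp_prodBaseChangeToProd : slice'_{λ̄'(P')} ≫ (A_{S'} ×_{S'} Â_{S'} → A ×_S Â) = e ≫ slice_{λ̄(e P')}`;
* §2 **[MFK94] Def. 6.2 «`Λ(L)(x) = T_x^*L ⊗ L⁻¹`» (the tree's `IsLambdaOfAt`) moves across `e` in both directions**:
  `detClass_translationPullback_tensor_dual` (`[t_P^*𝒪(Θ) ⊗ 𝒪(Θ)^∨] = t_P^*[Θ] · [Θ]⁻¹`; ★ `detClass_tensorObj_of_hasRank_one`,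
  ★ `detClass_dual`), `detClass_slicePullback_baseChange` (`[𝒫_{S'}|slice'] = e^*[𝒫|slice]`), `divisorBaseChange := e^*Θ`,
  **`IsLambdaOfAt.baseChange`** (`Θ ↦ e^*Θ`) and **`IsLambdaOfAt.of_baseChange`** (`Θ' ↦ (e⁻¹)^*Θ'`): both sides are
  rank-one modules on the integral fibre with equal classes in `Ȟ¹`, hence isomorphic (★ `nonempty_iso_iff_detClass_eq`).

## References
* [MumfordFogartyKirwan1994] D. Mumford, J. Fogarty, F. Kirwan, *Geometric Invariant Theory*, 3rd ed. (1994), Ch. 6 §2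
  Def. 6.2–6.3 (p. 120), Ch. 7 §2 Def. 7.2 (p. 129: the moduli functor «in the obvious way», by pull-back).
* [GortzWedhorn2020] U. Görtz, T. Wedhorn, *Algebraic Geometry I*, 2nd ed. (2020), Section (4.7) (p. 135), Prop. 11.21
  (p. 374), Def. 11.49 (p. 392).
* [Hartshorne1977] R. Hartshorne, *Algebraic Geometry* (1977), II Ex. 6.8, III Ex. 4.5 (`Pic X = Ȟ¹(X, 𝒪_X^×)`).
-/

universe u

open CategoryTheory CategoryTheory.Limits AlgebraicGeometry MonoidalCategory

noncomputable section

namespace Literature.AlgebraicGeometry.Modules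

open Literature.AlgebraicGeometry.Motives

variable {X Y Z : Scheme.{u}}

/-- `f^*(g^*γ) = (f ≫ g)^*γ` on `Ȟ¹(·, 𝒪^×)` — this is ★ `CechPic.pullback_comp` (`Modules/UnitCocyclePresented`) read
right to left, re-derived here (private plumbing) from `detClass_pullback` and `(f ≫ g)^*E ≅ f^*g^*E` because that
module lies outside this file's import cone. [cite: Hartshorne1977, II Ex. 6.8 (a)] -/
private theorem cechPic_pullback_pullback (f : X ⟶ Y) (g : Y ⟶ Z) (γ : CechPic Z) :
    CechPic.pullback f (CechPic.pullback g γ) = CechPic.pullback (f ≫ g) γ := by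
  obtain ⟨c, rfl⟩ := CechPic.mk_surjective γ
  have hE := c.isFiniteLocallyFree_lineBundle
  rw [← c.detClass_lineBundle, ← detClass_pullback, ← detClass_pullback, ← detClass_pullback]
  exact (detClass_eq_of_iso ((Scheme.Modules.pullbackComp f g).app (lineBundle c)).symm _ _).symm

end Literature.AlgebraicGeometry.Modules

namespace Literature.AlgebraicGeometry.AbelianSchemes

open Literature.AlgebraicGeometry.Motives Literature.AlgebraicGeometry.AbelianVarieties
  Literature.AlgebraicGeometry.Modules
open scoped MonObj CategoryTheory.Obj

namespace AbelianSchemeOver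

variable {S S' : Scheme.{u}} (A : AbelianSchemeOver S) (g : S' ⟶ S) (D : A.DualPair)
  {Ω : Type u} [Field Ω] (t : Spec (.of Ω) ⟶ S')

/-! ### §1 The points and slices of the fibre of a base change under `fibreBaseChangeIso` -/

/-- The underlying scheme morphism of `fibreBaseChangeIso` is an isomorphism. [cite: GortzWedhorn2020, Section (4.7) (p. 135)] -/
theorem isIso_toSchemeHom_fibreBaseChangeIso :
    IsIso (AbelianVariety.Hom.toSchemeHom (A.fibreBaseChangeIso g t).hom) :=
  ⟨⟨(A.baseChangeCompGrpIso g t).hom.hom.hom.left, A.baseChangeCompGrpIso_inv_left_hom_left g t,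
    A.baseChangeCompGrpIso_hom_left_inv_left g t⟩⟩

/-- The underlying scheme morphism of `fibreBaseChangeIso⁻¹` is an isomorphism. [cite: GortzWedhorn2020, Section (4.7) (p. 135)] -/
theorem isIso_toSchemeHom_fibreBaseChangeIso_inv :
    IsIso (AbelianVariety.Hom.toSchemeHom (A.fibreBaseChangeIso g t).inv) :=
  ⟨⟨(A.baseChangeCompGrpIso g t).inv.hom.hom.left, A.baseChangeCompGrpIso_hom_left_inv_left g t,
    A.baseChangeCompGrpIso_inv_left_hom_left g t⟩⟩

/-- `e.inv ≫ e.hom = 𝟙` on underlying schemes, `e = fibreBaseChangeIso`. [cite: GortzWedhorn2020, Section (4.7) (p. 135)] -/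
theorem toSchemeHom_fibreBaseChangeIso_inv_comp_hom :
    AbelianVariety.Hom.toSchemeHom (A.fibreBaseChangeIso g t).inv ≫
      AbelianVariety.Hom.toSchemeHom (A.fibreBaseChangeIso g t).hom = 𝟙 _ :=
  A.baseChangeCompGrpIso_hom_left_inv_left g t

/-- `e.hom ≫ e.inv = 𝟙` on underlying schemes, `e = fibreBaseChangeIso`. [cite: GortzWedhorn2020, Section (4.7) (p. 135)] -/
theorem toSchemeHom_fibreBaseChangeIso_hom_comp_inv :
    AbelianVariety.Hom.toSchemeHom (A.fibreBaseChangeIso g t).hom ≫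
      AbelianVariety.Hom.toSchemeHom (A.fibreBaseChangeIso g t).inv = 𝟙 _ :=
  A.baseChangeCompGrpIso_inv_left_hom_left g t

/-- **`e^*` is injective on `Ȟ¹(·, 𝒪^×)`** for the fibre identification `e` (`(e⁻¹)^* ∘ e^* = (e⁻¹ ≫ e)^* = id`).
[cite: Hartshorne1977, II Ex. 6.8 (a)] -/
theorem cechPic_pullback_fibreBaseChangeIso_injective :
    Function.Injective (CechPic.pullback (AbelianVariety.Hom.toSchemeHom (A.fibreBaseChangeIso g t).hom)) := by
  intro c₁ c₂ hc
  rw [← CechPic.pullback_id c₁, ← CechPic.pullback_id c₂, ← A.toSchemeHom_fibreBaseChangeIso_inv_comp_hom g t,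
    ← cechPic_pullback_pullback, ← cechPic_pullback_pullback]
  exact congrArg _ hc

/-- The point of `A_{t ≫ g}` corresponding to a point `P'` of `(A_{S'})_t`: its underlying morphism is `P' ≫ e`.
[cite: GortzWedhorn2020, Section (4.7) (p. 135)] -/
theorem map_fibreBaseChangeIso_left (P' : ((A.baseChange g).fibre t).toAbelianVariety.Points Ω) :
    ((AlgPoints.map (A.fibreBaseChangeIso g t).hom.hom.hom.hom P').left :
        Spec (.of Ω) ⟶ pullback A.X.hom (t ≫ g)) =
      (P'.left : Spec (.of Ω) ⟶ pullback (pullback.snd A.X.hom g) t) ≫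
        AbelianVariety.Hom.toSchemeHom (A.fibreBaseChangeIso g t).hom :=
  rfl

/-- The fibre identification on `Ω`-points, as a group isomorphism `(A_{S'})_t(Ω) ≃* A_{t ≫ g}(Ω)`
(`P' ↦ P' ≫ e`; multiplicative because `e` is a homomorphism, Mathlib `MonObj.mul_comp`).
[cite: GortzWedhorn2020, Section (4.7) (p. 135)] -/
def fibrePointsMulEquiv :
    ((A.baseChange g).fibre t).toAbelianVariety.Points Ω ≃* (A.fibre (t ≫ g)).toAbelianVariety.Points Ω where
  toFun := AlgPoints.map (A.fibreBaseChangeIso g t).hom.hom.hom.hom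
  invFun := AlgPoints.map (A.fibreBaseChangeIso g t).inv.hom.hom.hom
  left_inv P := by
    have h : (A.fibreBaseChangeIso g t).hom.hom.hom.hom ≫ (A.fibreBaseChangeIso g t).inv.hom.hom.hom = 𝟙 _ := by
      change ((A.fibreBaseChangeIso g t).hom ≫ (A.fibreBaseChangeIso g t).inv).hom.hom.hom = _
      rw [Iso.hom_inv_id]
      rfl
    change AlgPoints.map (A.fibreBaseChangeIso g t).inv.hom.hom.hom
      (AlgPoints.map (A.fibreBaseChangeIso g t).hom.hom.hom.hom P) = P
    rw [← AlgPoints.map_comp_apply, h, AlgPoints.map_id_apply]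
  right_inv P := by
    have h : (A.fibreBaseChangeIso g t).inv.hom.hom.hom ≫ (A.fibreBaseChangeIso g t).hom.hom.hom.hom = 𝟙 _ := by
      change ((A.fibreBaseChangeIso g t).inv ≫ (A.fibreBaseChangeIso g t).hom).hom.hom.hom = _
      rw [Iso.inv_hom_id]
      rfl
    change AlgPoints.map (A.fibreBaseChangeIso g t).hom.hom.hom.hom
      (AlgPoints.map (A.fibreBaseChangeIso g t).inv.hom.hom.hom P) = P
    rw [← AlgPoints.map_comp_apply, h, AlgPoints.map_id_apply]
  map_mul' P Q := MonObj.mul_comp P Q _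

/-- `fibrePointsMulEquiv` is `AlgPoints.map e`, `e = fibreBaseChangeIso` (definitional). [cite: GortzWedhorn2020, Section (4.7) (p. 135)] -/
theorem fibrePointsMulEquiv_apply (P' : ((A.baseChange g).fibre t).toAbelianVariety.Points Ω) :
    A.fibrePointsMulEquiv g t P' = AlgPoints.map (A.fibreBaseChangeIso g t).hom.hom.hom.hom P' := rfl

/-- **The value `λ̄'(P')` of the base-changed polarisation map projects to `λ̄(e P')`**: for `λ : A → Â` over `S`,
`((pr ≫ λ) read on the fibre at `t`) ≫ pr_Â = λ̄` at `e P'`. [cite: MumfordFogartyKirwan1994, Ch. 6 §2 Definition 6.3 (p. 120)] -/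
theorem valueAt_baseChange_comp_fst (lam : A.X ⟶ D.hat.X) (P' : ((A.baseChange g).fibre t).toAbelianVariety.Points Ω) :
    (A.baseChange g).valueAt t (D.baseChange g) ((Over.pullback g).map lam) P' ≫ pullback.fst D.hat.X.hom g =
      A.valueAt (t ≫ g) D lam (AlgPoints.map (A.fibreBaseChangeIso g t).hom.hom.hom.hom P') := by
  -- `λ'.left ≫ pr_Â = pr_A ≫ λ.left`
  have hlam : ((Over.pullback g).map lam).left ≫ pullback.fst D.hat.X.hom g = pullback.fst A.X.hom g ≫ lam.left := by
    simp only [Over.pullback_map_left]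
    erw [pullback.lift_fst]
  simp only [AbelianSchemeOver.valueAt, AbelianSchemeOver.fibrePointToLeft, Category.assoc]
  erw [hlam]
  symm
  erw [map_fibreBaseChangeIso_left, Category.assoc, A.fibreBaseChangeIso_hom_toSchemeHom_fst_assoc g t lam.left]
  rfl

/-- `λ̄'(P')` lies over `t`. [cite: MumfordFogartyKirwan1994, Ch. 6 §2 Definition 6.3 (p. 120)] -/
theorem valueAt_baseChange_comp_snd (lam : A.X ⟶ D.hat.X)
    (P' : ((A.baseChange g).fibre t).toAbelianVariety.Points Ω) :
    (A.baseChange g).valueAt t (D.baseChange g) ((Over.pullback g).map lam) P' ≫ pullback.snd D.hat.X.hom g = t :=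
  (A.baseChange g).valueAt_comp_hom t (D.baseChange g) ((Over.pullback g).map lam) P'

/-- **Values of `λ̄'` agree iff the values of `λ̄` at the corresponding points agree** (a point of `Â ×_S S'` over `t`
is determined by its projection to `Â`). [cite: MumfordFogartyKirwan1994, Ch. 6 §2 Definition 6.3 (p. 120)] -/
theorem valueAt_baseChange_eq_iff (lam : A.X ⟶ D.hat.X)
    (P' Q' : ((A.baseChange g).fibre t).toAbelianVariety.Points Ω) :
    (A.baseChange g).valueAt t (D.baseChange g) ((Over.pullback g).map lam) P' =
        (A.baseChange g).valueAt t (D.baseChange g) ((Over.pullback g).map lam) Q' ↔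
      A.valueAt (t ≫ g) D lam (AlgPoints.map (A.fibreBaseChangeIso g t).hom.hom.hom.hom P') =
        A.valueAt (t ≫ g) D lam (AlgPoints.map (A.fibreBaseChangeIso g t).hom.hom.hom.hom Q') := by
  constructor
  · intro h
    rw [← valueAt_baseChange_comp_fst, ← valueAt_baseChange_comp_fst, h]
  · intro h
    apply pullback.hom_ext
    · erw [A.valueAt_baseChange_comp_fst g D t lam P', A.valueAt_baseChange_comp_fst g D t lam Q', h]
    · erw [A.valueAt_baseChange_comp_snd g D t lam P', A.valueAt_baseChange_comp_snd g D t lam Q']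

/-- **The slice square**: the slice of `(A_{S'})_t` at `λ̄'(P')` followed by the comparison to `A ×_S Â` is the fibre
identification followed by the slice of `A_{t ≫ g}` at `λ̄(e P')`. [cite: MumfordFogartyKirwan1994, Ch. 6 §2 Definition 6.2 (p. 120)] -/
theorem sliceAt_baseChange_comp_prodBaseChangeToProd (lam : A.X ⟶ D.hat.X)
    (P' : ((A.baseChange g).fibre t).toAbelianVariety.Points Ω) :
    (A.baseChange g).sliceAt t (D.baseChange g) ((Over.pullback g).map lam) P' ≫ D.prodBaseChangeToProd g =
      AbelianVariety.Hom.toSchemeHom (A.fibreBaseChangeIso g t).hom ≫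
        A.sliceAt (t ≫ g) D lam (AlgPoints.map (A.fibreBaseChangeIso g t).hom.hom.hom.hom P') := by
  apply pullback.hom_ext
  · have e1 : ((A.baseChange g).sliceAt t (D.baseChange g) ((Over.pullback g).map lam) P' ≫
        D.prodBaseChangeToProd g) ≫ pullback.fst A.X.hom D.hat.X.hom =
        pullback.fst (A.baseChange g).X.hom t ≫ pullback.fst A.X.hom g := by
      erw [Category.assoc, D.prodBaseChangeToProd_fst g,
        (A.baseChange g).sliceAt_fst_assoc t (D.baseChange g) ((Over.pullback g).map lam) P'
          (pullback.fst A.X.hom g)]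
    have e2 : (AbelianVariety.Hom.toSchemeHom (A.fibreBaseChangeIso g t).hom ≫
        A.sliceAt (t ≫ g) D lam (AlgPoints.map (A.fibreBaseChangeIso g t).hom.hom.hom.hom P')) ≫
        pullback.fst A.X.hom D.hat.X.hom = pullback.fst (pullback.snd A.X.hom g) t ≫ pullback.fst A.X.hom g := by
      erw [Category.assoc, A.sliceAt_fst (t ≫ g) D lam (AlgPoints.map (A.fibreBaseChangeIso g t).hom.hom.hom.hom P'),
        A.fibreBaseChangeIso_hom_toSchemeHom_fst g t]
    exact e1.trans e2.symm
  · have e1 : ((A.baseChange g).sliceAt t (D.baseChange g) ((Over.pullback g).map lam) P' ≫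
        D.prodBaseChangeToProd g) ≫ pullback.snd A.X.hom D.hat.X.hom =
        pullback.snd (A.baseChange g).X.hom t ≫
          A.valueAt (t ≫ g) D lam (AlgPoints.map (A.fibreBaseChangeIso g t).hom.hom.hom.hom P') := by
      erw [Category.assoc, D.prodBaseChangeToProd_snd g,
        (A.baseChange g).sliceAt_snd_assoc t (D.baseChange g) ((Over.pullback g).map lam) P'
          (pullback.fst D.hat.X.hom g),
        A.valueAt_baseChange_comp_fst g D t lam P']
    have e2 : (AbelianVariety.Hom.toSchemeHom (A.fibreBaseChangeIso g t).hom ≫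
        A.sliceAt (t ≫ g) D lam (AlgPoints.map (A.fibreBaseChangeIso g t).hom.hom.hom.hom P')) ≫
        pullback.snd A.X.hom D.hat.X.hom =
        pullback.snd (pullback.snd A.X.hom g) t ≫
          A.valueAt (t ≫ g) D lam (AlgPoints.map (A.fibreBaseChangeIso g t).hom.hom.hom.hom P') := by
      erw [Category.assoc, A.sliceAt_snd (t ≫ g) D lam (AlgPoints.map (A.fibreBaseChangeIso g t).hom.hom.hom.hom P'),
        A.fibreBaseChangeIso_hom_toSchemeHom_snd_assoc g t
          (A.valueAt (t ≫ g) D lam (AlgPoints.map (A.fibreBaseChangeIso g t).hom.hom.hom.hom P'))]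
      rfl
    exact e1.trans e2.symm

/-! ### §2 `IsLambdaOfAt` descends along the fibre identification (both directions) -/
/-- **The class of Mumford's `T_x^*L ⊗ L⁻¹`** for `L = 𝒪(Θ)` on a fibre `A_s` and an `Ω`-point `P`: for any
finite-local-freeness witness, `[t_P^*𝒪(Θ) ⊗ 𝒪(Θ)^∨] = t_P^*[Θ] · [Θ]⁻¹` in `Ȟ¹(A_s, 𝒪^×)` (determinant class of a
tensor product of line bundles, of a pull-back, of a dual; `[𝒪(Θ)] = [Θ]`). [cite: MumfordFogartyKirwan1994, Ch. 6 §2 Definition 6.2 (p. 120)]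
[cite: Hartshorne1977, II Ex. 6.8 and III Ex. 4.5] -/
theorem detClass_translationPullback_tensor_dual {T : Scheme.{u}} (B : AbelianSchemeOver T) {Ω : Type u} [Field Ω]
    (s : Spec (.of Ω) ⟶ T) (Θ : CartierDivisor (B.fibre s).toAbelianVariety.X.left)
    (P : (B.fibre s).toAbelianVariety.Points Ω)
    (hfl : IsFiniteLocallyFree (tensorObj
      ((Scheme.Modules.pullback ((B.fibre s).toAbelianVariety.translation P).left).obj (B.lineBundleOfDivisor s Θ))
      (Modules.dual (B.lineBundleOfDivisor s Θ)))) :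
    detClass hfl =
      CechPic.pullback ((B.fibre s).toAbelianVariety.translation P).left Θ.cechClass * (Θ.cechClass)⁻¹ := by
  have fL : IsFiniteLocallyFree (B.lineBundleOfDivisor s Θ) := UnitCocycle.isFiniteLocallyFree_lineBundle _
  have cL : detClass fL = Θ.cechClass := detClass_lineBundle_toUnitCocycle Θ
  rw [detClass_tensorObj_of_hasRank_one (hasRank_pullback _ (B.hasRank_lineBundleOfDivisor s Θ))
      (hasRank_dual (B.hasRank_lineBundleOfDivisor s Θ)) (fL.pullback _) (isFiniteLocallyFree_dual fL) hfl,
    detClass_pullback _ fL, detClass_dual fL, cL]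

section Lambda

variable (lam : A.X ⟶ D.hat.X)

/-- **The class of the slice of `𝒫_{S'}` at `λ̄'(P')` is `e^*` of the class of the slice of `𝒫` at `λ̄(e P')`** (the
slice square `sliceAt_baseChange_comp_prodBaseChangeToProd` and `(f ≫ g)^* ≅ f^* g^*`; any witnesses).
[cite: MumfordFogartyKirwan1994, Ch. 6 §2 Definition 6.2 (p. 120)] [cite: Hartshorne1977, II Ex. 6.8 (a)] -/
theorem detClass_slicePullback_baseChange (P' : ((A.baseChange g).fibre t).toAbelianVariety.Points Ω)
    (hW' : IsFiniteLocallyFree ((Scheme.Modules.pullback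
      ((A.baseChange g).sliceAt t (D.baseChange g) ((Over.pullback g).map lam) P')).obj (D.baseChange g).P))
    (hW : IsFiniteLocallyFree ((Scheme.Modules.pullback
      (A.sliceAt (t ≫ g) D lam (AlgPoints.map (A.fibreBaseChangeIso g t).hom.hom.hom.hom P'))).obj D.P)) :
    detClass hW' = CechPic.pullback (AbelianVariety.Hom.toSchemeHom (A.fibreBaseChangeIso g t).hom) (detClass hW) :=
  have j : (Scheme.Modules.pullback
        ((A.baseChange g).sliceAt t (D.baseChange g) ((Over.pullback g).map lam) P')).obj (D.baseChange g).P ≅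
      (Scheme.Modules.pullback (AbelianVariety.Hom.toSchemeHom (A.fibreBaseChangeIso g t).hom)).obj
        ((Scheme.Modules.pullback
          (A.sliceAt (t ≫ g) D lam (AlgPoints.map (A.fibreBaseChangeIso g t).hom.hom.hom.hom P'))).obj D.P) :=
    (Scheme.Modules.pullbackComp _ _).app D.P ≪≫
      (Scheme.Modules.pullbackCongr (A.sliceAt_baseChange_comp_prodBaseChangeToProd g D t lam P')).app D.P ≪≫
      ((Scheme.Modules.pullbackComp _ _).app D.P).symm
  (detClass_eq_of_iso j hW' (hW.pullback _)).trans (detClass_pullback _ hW)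

variable (Θ : CartierDivisor (A.fibre (t ≫ g)).toAbelianVariety.X.left)

/-- The pulled-back divisor `e^*Θ` on the fibre `(A_{S'})_t` (along the dominant isomorphism `e`; non-Prop plumbing).
[cite: GortzWedhorn2020, Def. 11.49 (p. 392)] -/
abbrev divisorBaseChange : CartierDivisor ((A.baseChange g).fibre t).toAbelianVariety.X.left :=
  haveI := A.isIso_toSchemeHom_fibreBaseChangeIso g t
  Θ.pullback (AbelianVariety.Hom.toSchemeHom (A.fibreBaseChangeIso g t).hom)

/-- `[e^*Θ] = e^*[Θ]` in `Ȟ¹((A_{S'})_t, 𝒪^×)`. [cite: GortzWedhorn2020, Prop. 11.21 (p. 374) and Def. 11.49 (p. 392)] -/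
theorem cechClass_divisorBaseChange :
    (A.divisorBaseChange g t Θ).cechClass =
      CechPic.pullback (AbelianVariety.Hom.toSchemeHom (A.fibreBaseChangeIso g t).hom) Θ.cechClass :=
  haveI := A.isIso_toSchemeHom_fibreBaseChangeIso g t
  CartierDivisor.cechClass_pullback Θ _

/-- **`λ̄ = Λ(𝒪(Θ))` at `t ≫ g` implies `λ̄' = Λ(𝒪(e^*Θ))` at `t` for the base change**: both sides of Mumford's identity
are rank-one modules on the integral fibre `(A_{S'})_t` with the same class — `[𝒫_{S'}|slice'_{λ̄'(P')}] = e^*[𝒫|slice_{λ̄(eP')}]`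
(`detClass_slicePullback_baseChange`) `= e^*(t_{eP'}^*[Θ]·[Θ]⁻¹) = t_{P'}^*[e^*Θ]·[e^*Θ]⁻¹` (`t_{P'} ≫ e = e ≫ t_{eP'}`) — hence
isomorphic (`nonempty_iso_iff_detClass_eq`). [cite: MumfordFogartyKirwan1994, Ch. 6 §2 Definition 6.2–6.3 (p. 120)]
[cite: Hartshorne1977, III Ex. 4.5] -/
theorem IsLambdaOfAt.baseChange (h : A.IsLambdaOfAt (t ≫ g) D lam Θ) :
    (A.baseChange g).IsLambdaOfAt t (D.baseChange g) ((Over.pullback g).map lam) (A.divisorBaseChange g t Θ) := by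
  intro P'
  obtain ⟨i⟩ := h (AlgPoints.map (A.fibreBaseChangeIso g t).hom.hom.hom.hom P')
  have hl' : HasRank ((Scheme.Modules.pullback
      ((A.baseChange g).sliceAt t (D.baseChange g) ((Over.pullback g).map lam) P')).obj (D.baseChange g).P) 1 :=
    hasRank_pullback _ (D.hasRank_PBaseChange g)
  have hl : HasRank ((Scheme.Modules.pullback
      (A.sliceAt (t ≫ g) D lam (AlgPoints.map (A.fibreBaseChangeIso g t).hom.hom.hom.hom P'))).obj D.P) 1 :=
    hasRank_pullback _ D.hasRank_one
  have hr' : HasRank (tensorObj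
      ((Scheme.Modules.pullback (((A.baseChange g).fibre t).toAbelianVariety.translation P').left).obj
        ((A.baseChange g).lineBundleOfDivisor t (A.divisorBaseChange g t Θ)))
      (Modules.dual ((A.baseChange g).lineBundleOfDivisor t (A.divisorBaseChange g t Θ)))) 1 :=
    hasRank_tensorObj_one (hasRank_pullback _ ((A.baseChange g).hasRank_lineBundleOfDivisor t _))
      (hasRank_dual ((A.baseChange g).hasRank_lineBundleOfDivisor t _))
  have hr : HasRank (tensorObj
      ((Scheme.Modules.pullback ((A.fibre (t ≫ g)).toAbelianVariety.translation
        (AlgPoints.map (A.fibreBaseChangeIso g t).hom.hom.hom.hom P')).left).obj (A.lineBundleOfDivisor (t ≫ g) Θ))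
      (Modules.dual (A.lineBundleOfDivisor (t ≫ g) Θ))) 1 :=
    hasRank_tensorObj_one (hasRank_pullback _ (A.hasRank_lineBundleOfDivisor _ Θ))
      (hasRank_dual (A.hasRank_lineBundleOfDivisor _ Θ))
  refine (nonempty_iso_iff_detClass_eq hl' hr' (HasRank.isFiniteLocallyFree' hl')
    (HasRank.isFiniteLocallyFree' hr')).2 ?_
  have hnat := AbelianVariety.translation_left_comp_toSchemeHom (A.fibreBaseChangeIso g t).hom P'
  have lhs_eq : detClass (HasRank.isFiniteLocallyFree' hl') =
      CechPic.pullback (AbelianVariety.Hom.toSchemeHom (A.fibreBaseChangeIso g t).hom)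
        (CechPic.pullback ((A.fibre (t ≫ g)).toAbelianVariety.translation
          (AlgPoints.map (A.fibreBaseChangeIso g t).hom.hom.hom.hom P')).left Θ.cechClass * (Θ.cechClass)⁻¹) :=
    (A.detClass_slicePullback_baseChange g D t lam P' _ (HasRank.isFiniteLocallyFree' hl)).trans
      (congrArg (CechPic.pullback (AbelianVariety.Hom.toSchemeHom (A.fibreBaseChangeIso g t).hom))
        ((detClass_eq_of_iso i _ (HasRank.isFiniteLocallyFree' hr)).trans
          (A.detClass_translationPullback_tensor_dual (t ≫ g) Θ _ _)))
  have mid : CechPic.pullback (AbelianVariety.Hom.toSchemeHom (A.fibreBaseChangeIso g t).hom)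
        (CechPic.pullback ((A.fibre (t ≫ g)).toAbelianVariety.translation
          (AlgPoints.map (A.fibreBaseChangeIso g t).hom.hom.hom.hom P')).left Θ.cechClass * (Θ.cechClass)⁻¹) =
      CechPic.pullback (((A.baseChange g).fibre t).toAbelianVariety.translation P').left
        (CechPic.pullback (AbelianVariety.Hom.toSchemeHom (A.fibreBaseChangeIso g t).hom) Θ.cechClass) *
        (CechPic.pullback (AbelianVariety.Hom.toSchemeHom (A.fibreBaseChangeIso g t).hom) Θ.cechClass)⁻¹ := by
    rw [map_mul, map_inv, cechPic_pullback_pullback, cechPic_pullback_pullback, hnat]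
  have rhs_eq : detClass (HasRank.isFiniteLocallyFree' hr') =
      CechPic.pullback (((A.baseChange g).fibre t).toAbelianVariety.translation P').left
        (CechPic.pullback (AbelianVariety.Hom.toSchemeHom (A.fibreBaseChangeIso g t).hom) Θ.cechClass) *
        (CechPic.pullback (AbelianVariety.Hom.toSchemeHom (A.fibreBaseChangeIso g t).hom) Θ.cechClass)⁻¹ := by
    rw [(A.baseChange g).detClass_translationPullback_tensor_dual t (A.divisorBaseChange g t Θ) P'
      (HasRank.isFiniteLocallyFree' hr'), A.cechClass_divisorBaseChange g t Θ]
  exact lhs_eq.trans (mid.trans rhs_eq.symm)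

/-- **Conversely, `λ̄' = Λ(𝒪(Θ'))` at `t` implies `λ̄ = Λ(𝒪((e⁻¹)^*Θ'))` at `t ≫ g`**: at `P = e P'`,
`e^*[𝒫|slice_{λ̄(P)}] = [𝒫_{S'}|slice'_{λ̄'(P')}] = t_{P'}^*[Θ']·[Θ']⁻¹ = e^*(t_P^*[(e⁻¹)^*Θ']·[(e⁻¹)^*Θ']⁻¹)` (`[Θ'] = e^*[(e⁻¹)^*Θ']`
as `e^*(e⁻¹)^*Θ' ∼ Θ'`), and `e^*` is injective on `Ȟ¹`.  This is the transfer hypothesis `hpol` of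
`LevelStructure.IsSymplecticLiftable.of_fibreIso` for the base change. [cite: MumfordFogartyKirwan1994, Ch. 6 §2 Definition 6.2–6.3 (p. 120) and Ch. 7 §2 Definition 7.2 (p. 129)]
[cite: Hartshorne1977, III Ex. 4.5] -/
theorem IsLambdaOfAt.of_baseChange (Θ' : CartierDivisor ((A.baseChange g).fibre t).toAbelianVariety.X.left)
    (h' : (A.baseChange g).IsLambdaOfAt t (D.baseChange g) ((Over.pullback g).map lam) Θ') :
    haveI : IsDominant (AbelianVariety.Hom.toSchemeHom (A.fibreBaseChangeIso g t).inv) :=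
      AbelianVariety.isDominant_toSchemeHom_iso_hom (A.fibreBaseChangeIso g t).symm
    A.IsLambdaOfAt (t ≫ g) D lam (Θ'.pullback (AbelianVariety.Hom.toSchemeHom (A.fibreBaseChangeIso g t).inv)) := by
  haveI hinv : IsDominant (AbelianVariety.Hom.toSchemeHom (A.fibreBaseChangeIso g t).inv) :=
    AbelianVariety.isDominant_toSchemeHom_iso_hom (A.fibreBaseChangeIso g t).symm
  haveI := A.isIso_toSchemeHom_fibreBaseChangeIso g t
  intro P
  have hP : AlgPoints.map (A.fibreBaseChangeIso g t).hom.hom.hom.hom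
      (AlgPoints.map (A.fibreBaseChangeIso g t).inv.hom.hom.hom P) = P :=
    (A.fibrePointsMulEquiv g t).apply_symm_apply P
  obtain ⟨P', rfl⟩ : ∃ P', AlgPoints.map (A.fibreBaseChangeIso g t).hom.hom.hom.hom P' = P := ⟨_, hP⟩
  obtain ⟨i'⟩ := h' P'
  have hsame : ((Θ'.pullback (AbelianVariety.Hom.toSchemeHom (A.fibreBaseChangeIso g t).inv)).pullback
      (AbelianVariety.Hom.toSchemeHom (A.fibreBaseChangeIso g t).hom)).SameDivisor Θ' :=
    ((Θ'.pullback_pullback_sameDivisor _ _).trans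
      (Θ'.pullback_congr_sameDivisor (A.toSchemeHom_fibreBaseChangeIso_hom_comp_inv g t))).trans
      Θ'.pullback_id_sameDivisor
  have hΘ : Θ'.cechClass = CechPic.pullback (AbelianVariety.Hom.toSchemeHom (A.fibreBaseChangeIso g t).hom)
      (Θ'.pullback (AbelianVariety.Hom.toSchemeHom (A.fibreBaseChangeIso g t).inv)).cechClass := by
    rw [← CartierDivisor.cechClass_pullback, hsame.cechClass_eq]
  have hl' : HasRank ((Scheme.Modules.pullback
      ((A.baseChange g).sliceAt t (D.baseChange g) ((Over.pullback g).map lam) P')).obj (D.baseChange g).P) 1 :=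
    hasRank_pullback _ (D.hasRank_PBaseChange g)
  have hl : HasRank ((Scheme.Modules.pullback
      (A.sliceAt (t ≫ g) D lam (AlgPoints.map (A.fibreBaseChangeIso g t).hom.hom.hom.hom P'))).obj D.P) 1 :=
    hasRank_pullback _ D.hasRank_one
  have hr' : HasRank (tensorObj
      ((Scheme.Modules.pullback (((A.baseChange g).fibre t).toAbelianVariety.translation P').left).obj
        ((A.baseChange g).lineBundleOfDivisor t Θ'))
      (Modules.dual ((A.baseChange g).lineBundleOfDivisor t Θ'))) 1 :=
    hasRank_tensorObj_one (hasRank_pullback _ ((A.baseChange g).hasRank_lineBundleOfDivisor t _))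
      (hasRank_dual ((A.baseChange g).hasRank_lineBundleOfDivisor t _))
  have hr : HasRank (tensorObj
      ((Scheme.Modules.pullback ((A.fibre (t ≫ g)).toAbelianVariety.translation
        (AlgPoints.map (A.fibreBaseChangeIso g t).hom.hom.hom.hom P')).left).obj (A.lineBundleOfDivisor (t ≫ g)
          (Θ'.pullback (AbelianVariety.Hom.toSchemeHom (A.fibreBaseChangeIso g t).inv))))
      (Modules.dual (A.lineBundleOfDivisor (t ≫ g)
        (Θ'.pullback (AbelianVariety.Hom.toSchemeHom (A.fibreBaseChangeIso g t).inv))))) 1 :=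
    hasRank_tensorObj_one (hasRank_pullback _ (A.hasRank_lineBundleOfDivisor _ _))
      (hasRank_dual (A.hasRank_lineBundleOfDivisor _ _))
  refine (nonempty_iso_iff_detClass_eq hl hr (HasRank.isFiniteLocallyFree' hl)
    (HasRank.isFiniteLocallyFree' hr)).2 (A.cechPic_pullback_fibreBaseChangeIso_injective g t ?_)
  have hnat := AbelianVariety.translation_left_comp_toSchemeHom (A.fibreBaseChangeIso g t).hom P'
  have lhs' : detClass (HasRank.isFiniteLocallyFree' hl') =
      CechPic.pullback (AbelianVariety.Hom.toSchemeHom (A.fibreBaseChangeIso g t).hom)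
        (detClass (HasRank.isFiniteLocallyFree' hl)) :=
    A.detClass_slicePullback_baseChange g D t lam P' _ _
  have rhs' : detClass (HasRank.isFiniteLocallyFree' hr') =
      CechPic.pullback (AbelianVariety.Hom.toSchemeHom (A.fibreBaseChangeIso g t).hom)
        (detClass (HasRank.isFiniteLocallyFree' hr)) := by
    rw [(A.baseChange g).detClass_translationPullback_tensor_dual t Θ' P' (HasRank.isFiniteLocallyFree' hr'),
      A.detClass_translationPullback_tensor_dual (t ≫ g) _ _ (HasRank.isFiniteLocallyFree' hr), hΘ, map_mul, map_inv,
      cechPic_pullback_pullback, cechPic_pullback_pullback, hnat]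
  exact lhs'.symm.trans ((detClass_eq_of_iso i' _ (HasRank.isFiniteLocallyFree' hr')).trans rhs')

end Lambda

end AbelianSchemeOver

end Literature.AlgebraicGeometry.AbelianSchemes

end
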